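import Literature.NumberTheory.Rogawski1990.LocalTransferTransportPoint
import Literature.NumberTheory.Automorphic.UnitaryGroupOrbitalMeasureFamilyOfLocal
import HarnessLib

/-!
# The transported family read at a point, over `OrbitalMeasureFamily.atPoint`: `(ψ_* m′).atPoint a = (cosetCongr ψ)_* (m′.atPoint (ψ⁻¹ a))`,
# and the a.e. normalisation of the kit's quasi-split family `mq v = (ψ_v)_* mG v` from the inner form's
(Rogawski (1990), §4.3 p. 44: «vol `T(𝒪_v)` … for almost all v»; §14.2 p. 232: the fixed inner isomorphism `ψ`; Gelbart (1975), §10 pp. 154–155)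

Topic `NumberTheory/Rogawski1990`; namespace `Literature.NumberTheory.Rogawski1990` (sequel of ★ `LocalTransferTransportPoint` over ★ Q4-C2
`UnitaryGroupOrbitalMeasureFamilyOfLocal`).  THEOREMS ONLY: no definition, no named fact, no instance, no `sorry`.  Cell `pub/hodgecm-mathlib`,
ENGINE T1: SPEC-ed1.19 (viii′-3) «`∃ S₀, UnitaryGroup.IsNormalisedOff L 3 H 𝔨.mG (toAdelic (out c)) S₀`» and 1.19c's SJ sockets reading the
adelic-class-indexed family built from `𝔨.mq := transport of 𝔨.mG` (Q4-C3 `ofLocalAdelic`), whose normalisability hypothesis is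
`IsNormalisedOff L 3 Φ₃ 𝔨.mq x S₀` at adelic points `x` of `U(Φ₃)`.

* §1 (generic `ψ : B ≃* A` bicontinuous, `m′[ψ⁻¹ a]` invariant) **`OrbitalMeasureFamily.transport_atPoint`**: `(ψ_* m′).atPoint a =
  (cosetCongr ψ)_* (m′.atPoint (ψ⁻¹ a))` (★ `map_conj_transport_mk_eq` at the conjugators `conjOut a`, `conjOut (ψ⁻¹ a)` of ★ `atPoint`);
  **`….transport_atPoint_apply_image_mk`**: `((ψ_* m′).atPoint a)(π K) = (m′.atPoint (ψ⁻¹ a))(π ψ⁻¹K)`.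
* §2 (CM dress, `ψ_v : U(H)(L⁺_v) ≃ₜ* U(Φ₃)(L⁺_v)` matching the integral levels ★ `cmLocalIntegralLevel`, as (Ψ⁺)
  `exists_psi_corresponds_forall_levelMatching` provides off `S₀`) **`transport_atPoint_image_cmLocalIntegralLevel`**: the `π U(Φ₃)(𝒪_v)`-mass of
  `mq v` at `x_v` IS the `π U(H)(𝒪_v)`-mass of `mG v` at `ψ_v⁻¹ x_v`; **`isNormalisedOff_transport`**: hence `UnitaryGroup.IsNormalisedOff L 3 Φ₃ mq x S₀`
  from the masses of `mG` at the `ψ_v⁻¹ x_v`, `v ∉ S₀` (invariance of `mG v` at those classes as a hypothesis — for the kit: admissibility on the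
  regular classes and `x` regular).
HC_CM is proved only modulo the printed citations until rung 0 closes; this file is unconditional.

## References
* [Rogawski1990] J. D. Rogawski, *Automorphic Representations of Unitary Groups in Three Variables*, Ann. of Math. Stud. 123 (1990), §4.3 p. 44,
  §14.2 (14.2.1) p. 232.
* [Gelbart1975] S. Gelbart, *Automorphic forms on adele groups*, Ann. of Math. Stud. 83 (1975), §10 pp. 154–155, (9.13).
-/

set_option autoImplicit false

noncomputable section

open MeasureTheory Topology
open scoped Pointwise

namespace Literature.NumberTheory.Rogawski1990

open Literature.MeasureTheory.Group Literature.NumberTheory.Automorphic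

/-! ## §1 Over Q4-C2's `OrbitalMeasureFamily.atPoint`: `(ψ_* m′).atPoint a = (cosetCongr ψ)_* (m′.atPoint (ψ⁻¹ a))` -/

section AtPoint

variable {A B : Type*} [Group A] [Group B] (ψ : B ≃* A) [TopologicalSpace A] [TopologicalSpace B] [IsTopologicalGroup A]
  [IsTopologicalGroup B] (hψ : Continuous ψ) (hψs : Continuous ψ.symm)
  [∀ a : A, MeasurableSpace (A ⧸ Subgroup.centralizer ({a} : Set A))] [∀ a : A, BorelSpace (A ⧸ Subgroup.centralizer ({a} : Set A))]
  [∀ b : B, MeasurableSpace (B ⧸ Subgroup.centralizer ({b} : Set B))] [∀ b : B, BorelSpace (B ⧸ Subgroup.centralizer ({b} : Set B))]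
  (m' : OrbitalMeasureFamily B)

/-- **`(ψ_* m′).atPoint a = (cosetCongr ψ)_* (m′.atPoint (ψ⁻¹ a))`** for `m′[ψ⁻¹ a]` invariant: the transported family READ AT THE POINT `a`
(★ `OrbitalMeasureFamily.atPoint`, through the chosen conjugator `conjOut a`) is the family read at `ψ⁻¹ a` (through `conjOut (ψ⁻¹ a)`) pushed
along the CANONICAL identification `B ⧸ C(ψ⁻¹ a) ≃ A ⧸ C(a)` induced by `ψ` itself — no choice survives (★ `map_conj_transport_mk_eq`).
[cite: Gelbart1975, §10 pp. 154–155] -/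
theorem _root_.Literature.NumberTheory.Automorphic.OrbitalMeasureFamily.transport_atPoint (a : A)
    [SMulInvariantMeasure B (B ⧸ Subgroup.centralizer ({(Quotient.out (ConjClasses.mk (ψ.symm a)) : B)} : Set B))
      (m' (ConjClasses.mk (ψ.symm a)))] :
    (m'.transport ψ hψ hψs).atPoint a =
      (m'.atPoint (ψ.symm a)).map (cosetCongr ψ (Subgroup.centralizer ({ψ.symm a} : Set B)) (Subgroup.centralizer ({a} : Set A))
        (forall_apply_mem_centralizer_singleton_iff_of_eq ψ (ψ.apply_symm_apply a))) :=
  map_conj_transport_mk_eq ψ hψ hψs m' a (conjOut a) (conj_conjOut_out a) (conjOut (ψ.symm a)) (conj_conjOut_out (ψ.symm a))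

/-- **The `π(K)`-mass of `(ψ_* m′).atPoint a` is the `π(ψ⁻¹K)`-mass of `m′.atPoint (ψ⁻¹ a)`** (`m′[ψ⁻¹ a]` invariant; ★
`map_conj_transport_mk_apply_image_mk`). [cite: Rogawski1990, §4.3 p. 44] [cite: Gelbart1975, §10 pp. 154–155] -/
theorem _root_.Literature.NumberTheory.Automorphic.OrbitalMeasureFamily.transport_atPoint_apply_image_mk (a : A)
    [SMulInvariantMeasure B (B ⧸ Subgroup.centralizer ({(Quotient.out (ConjClasses.mk (ψ.symm a)) : B)} : Set B))
      (m' (ConjClasses.mk (ψ.symm a)))] (K : Set A) :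
    ((m'.transport ψ hψ hψs).atPoint a) ((QuotientGroup.mk : A → A ⧸ Subgroup.centralizer ({a} : Set A)) '' K) =
      (m'.atPoint (ψ.symm a)) ((QuotientGroup.mk : B → B ⧸ Subgroup.centralizer ({ψ.symm a} : Set B)) '' (ψ.symm '' K)) :=
  map_conj_transport_mk_apply_image_mk ψ hψ hψs m' a (conjOut a) (conj_conjOut_out a) (conjOut (ψ.symm a)) (conj_conjOut_out (ψ.symm a)) K

end AtPoint

/-! ## §2 The CM dress: the quasi-split family `mq v = (ψ_v)_* mG v` is normalised at `x_v` on `π U(Φ₃)(𝒪_v)` iff `mG v` is at `ψ_v⁻¹ x_v` on `π U(H)(𝒪_v)` -/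

section CMDress

open NumberField IsDedekindDomain
open scoped Matrix MatrixGroups

variable (L : Type) [Field L] [NumberField L] [IsCMField L] (H : Matrix (Fin 3) (Fin 3) L)
  [∀ (v : HeightOneSpectrum (𝓞 ↥(maximalRealSubfield L))) (γ : (UnitaryGroup.cmDatum L 3 H).Local v),
    MeasurableSpace ((UnitaryGroup.cmDatum L 3 H).Local v ⧸ Subgroup.centralizer ({γ} : Set ((UnitaryGroup.cmDatum L 3 H).Local v)))]
  [∀ (v : HeightOneSpectrum (𝓞 ↥(maximalRealSubfield L))) (γ : (UnitaryGroup.cmDatum L 3 H).Local v),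
    BorelSpace ((UnitaryGroup.cmDatum L 3 H).Local v ⧸ Subgroup.centralizer ({γ} : Set ((UnitaryGroup.cmDatum L 3 H).Local v)))]
  [∀ (v : HeightOneSpectrum (𝓞 ↥(maximalRealSubfield L)))
    (γ : (UnitaryGroup.cmDatum L 3 (Matrix.of fun i j : Fin 3 => if i.val + j.val + 1 = 3 then (1 : L) else 0)).Local v),
    MeasurableSpace ((UnitaryGroup.cmDatum L 3 (Matrix.of fun i j : Fin 3 => if i.val + j.val + 1 = 3 then (1 : L) else 0)).Local v ⧸
      Subgroup.centralizer ({γ} : Set ((UnitaryGroup.cmDatum L 3 (Matrix.of fun i j : Fin 3 => if i.val + j.val + 1 = 3 then (1 : L) else 0)).Local v)))]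
  [∀ (v : HeightOneSpectrum (𝓞 ↥(maximalRealSubfield L)))
    (γ : (UnitaryGroup.cmDatum L 3 (Matrix.of fun i j : Fin 3 => if i.val + j.val + 1 = 3 then (1 : L) else 0)).Local v),
    BorelSpace ((UnitaryGroup.cmDatum L 3 (Matrix.of fun i j : Fin 3 => if i.val + j.val + 1 = 3 then (1 : L) else 0)).Local v ⧸
      Subgroup.centralizer ({γ} : Set ((UnitaryGroup.cmDatum L 3 (Matrix.of fun i j : Fin 3 => if i.val + j.val + 1 = 3 then (1 : L) else 0)).Local v)))]
  (ψ : ∀ v : HeightOneSpectrum (𝓞 ↥(maximalRealSubfield L)), (UnitaryGroup.cmDatum L 3 H).Local v ≃ₜ*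
    (UnitaryGroup.cmDatum L 3 (Matrix.of fun i j : Fin 3 => if i.val + j.val + 1 = 3 then (1 : L) else 0)).Local v)
  (mG : ∀ v : HeightOneSpectrum (𝓞 ↥(maximalRealSubfield L)), OrbitalMeasureFamily ((UnitaryGroup.cmDatum L 3 H).Local v))

/-- **The `π U(Φ₃)(𝒪_v)`-mass of the kit's quasi-split family at `x_v` IS the `π U(H)(𝒪_v)`-mass of the inner form's family at `ψ_v⁻¹ x_v`**
whenever `ψ_v` matches the integral levels (`ψ_v g ∈ U(Φ₃)(𝒪_v) ↔ g ∈ U(H)(𝒪_v)`, ★ (Ψ⁺) `exists_psi_corresponds_forall_levelMatching` off `S₀`) and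
`mG v` is invariant at the class of `ψ_v⁻¹ x_v` (§1 `transport_atPoint_apply_image_mk` with `ψ_v⁻¹ U(Φ₃)(𝒪_v) = U(H)(𝒪_v)`).
[cite: Rogawski1990, §4.3 p. 44; §14.2 p. 232] -/
theorem transport_atPoint_image_cmLocalIntegralLevel (v : HeightOneSpectrum (𝓞 ↥(maximalRealSubfield L)))
    (hψK : ∀ g, ψ v g ∈ UnitaryGroup.cmLocalIntegralLevel L 3 (Matrix.of fun i j : Fin 3 => if i.val + j.val + 1 = 3 then (1 : L) else 0) v ↔
      g ∈ UnitaryGroup.cmLocalIntegralLevel L 3 H v)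
    (x : (UnitaryGroup.cmDatum L 3 (Matrix.of fun i j : Fin 3 => if i.val + j.val + 1 = 3 then (1 : L) else 0)).Local v)
    [hinv : SMulInvariantMeasure ((UnitaryGroup.cmDatum L 3 H).Local v)
      ((UnitaryGroup.cmDatum L 3 H).Local v ⧸ Subgroup.centralizer ({(Quotient.out (ConjClasses.mk ((ψ v).symm x)) : (UnitaryGroup.cmDatum L 3 H).Local v)} :
        Set ((UnitaryGroup.cmDatum L 3 H).Local v))) ((mG v) (ConjClasses.mk ((ψ v).symm x)))] :
    (((mG v).transport (ψ v).toMulEquiv (ψ v).continuous (ψ v).symm.continuous).atPoint x)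
        ((QuotientGroup.mk : _ → (UnitaryGroup.cmDatum L 3 (Matrix.of fun i j : Fin 3 => if i.val + j.val + 1 = 3 then (1 : L) else 0)).Local v ⧸
            Subgroup.centralizer ({x} : Set _)) ''
          (UnitaryGroup.cmLocalIntegralLevel L 3 (Matrix.of fun i j : Fin 3 => if i.val + j.val + 1 = 3 then (1 : L) else 0) v : Set _)) =
      ((mG v).atPoint ((ψ v).symm x))
        ((QuotientGroup.mk : _ → (UnitaryGroup.cmDatum L 3 H).Local v ⧸ Subgroup.centralizer ({(ψ v).symm x} : Set _)) ''
          (UnitaryGroup.cmLocalIntegralLevel L 3 H v : Set _)) := by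
  -- the generic lemma speaks of `(ψ_v : ≃*)⁻¹`; the statement of `(ψ_v : ≃ₜ*)⁻¹` — the same map
  haveI : SMulInvariantMeasure ((UnitaryGroup.cmDatum L 3 H).Local v)
      ((UnitaryGroup.cmDatum L 3 H).Local v ⧸ Subgroup.centralizer
        ({(Quotient.out (ConjClasses.mk ((ψ v).toMulEquiv.symm x)) : (UnitaryGroup.cmDatum L 3 H).Local v)} :
          Set ((UnitaryGroup.cmDatum L 3 H).Local v))) ((mG v) (ConjClasses.mk ((ψ v).toMulEquiv.symm x))) := hinv
  change _ = ((mG v).atPoint ((ψ v).toMulEquiv.symm x))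
    ((QuotientGroup.mk : _ → (UnitaryGroup.cmDatum L 3 H).Local v ⧸ Subgroup.centralizer ({(ψ v).toMulEquiv.symm x} : Set _)) ''
      (UnitaryGroup.cmLocalIntegralLevel L 3 H v : Set _))
  rw [OrbitalMeasureFamily.transport_atPoint_apply_image_mk]
  congr 2
  ext g
  simp only [Set.mem_image, SetLike.mem_coe]
  constructor
  · rintro ⟨k, hk, rfl⟩
    rw [← hψK]
    simpa using hk
  · intro hg
    exact ⟨ψ v g, (hψK g).2 hg, (ψ v).toMulEquiv.symm_apply_apply g⟩

/-- **`IsNormalisedOff` passes from the inner form to the quasi-split form**: if `ψ_v` matches the integral levels off `S₀` and, off `S₀`, `mG v` is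
invariant at the class of `ψ_v⁻¹ x_v` and gives `π U(H)(𝒪_v)` mass `1` there, then the transported family `mq v := (ψ_v)_* mG v` is normalised at
`x` off `S₀` in the sense of ★ Q4-C2 `UnitaryGroup.IsNormalisedOff` (the hypothesis of ★ `AdelicOrbitalMeasureFamily.ofLocal_eq` ∕ Q4-C3 for the
quasi-split group). [cite: Rogawski1990, §4.3 p. 44; §14.2 p. 232] -/
theorem isNormalisedOff_transport
    [∀ g : (UnitaryGroup.cmDatum L 3 (Matrix.of fun i j : Fin 3 => if i.val + j.val + 1 = 3 then (1 : L) else 0)).Adelic,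
      MeasurableSpace ((UnitaryGroup.cmDatum L 3 (Matrix.of fun i j : Fin 3 => if i.val + j.val + 1 = 3 then (1 : L) else 0)).Adelic ⧸
        Subgroup.centralizer ({g} : Set (UnitaryGroup.cmDatum L 3 (Matrix.of fun i j : Fin 3 => if i.val + j.val + 1 = 3 then (1 : L) else 0)).Adelic))]
    [∀ a : UnitaryGroup.arch (↥(maximalRealSubfield L)) L (IsCMField.complexConj L) 3 (Matrix.of fun i j : Fin 3 => if i.val + j.val + 1 = 3 then (1 : L) else 0),
      MeasurableSpace (UnitaryGroup.arch (↥(maximalRealSubfield L)) L (IsCMField.complexConj L) 3 (Matrix.of fun i j : Fin 3 => if i.val + j.val + 1 = 3 then (1 : L) else 0) ⧸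
        Subgroup.centralizer ({a} : Set (UnitaryGroup.arch (↥(maximalRealSubfield L)) L (IsCMField.complexConj L) 3
          (Matrix.of fun i j : Fin 3 => if i.val + j.val + 1 = 3 then (1 : L) else 0))))]
    (S₀ : Finset (HeightOneSpectrum (𝓞 ↥(maximalRealSubfield L))))
    (hψK : ∀ v ∉ S₀, ∀ g, ψ v g ∈ UnitaryGroup.cmLocalIntegralLevel L 3 (Matrix.of fun i j : Fin 3 => if i.val + j.val + 1 = 3 then (1 : L) else 0) v ↔
      g ∈ UnitaryGroup.cmLocalIntegralLevel L 3 H v)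
    (x : (UnitaryGroup.cmDatum L 3 (Matrix.of fun i j : Fin 3 => if i.val + j.val + 1 = 3 then (1 : L) else 0)).Adelic)
    (hinv : ∀ v ∉ S₀, SMulInvariantMeasure ((UnitaryGroup.cmDatum L 3 H).Local v)
      ((UnitaryGroup.cmDatum L 3 H).Local v ⧸ Subgroup.centralizer
        ({(Quotient.out (ConjClasses.mk ((ψ v).symm ((UnitaryGroup.cmDatum L 3 (Matrix.of fun i j : Fin 3 => if i.val + j.val + 1 = 3 then (1 : L) else 0)).toLocal v x))) :
          (UnitaryGroup.cmDatum L 3 H).Local v)} : Set ((UnitaryGroup.cmDatum L 3 H).Local v)))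
      ((mG v) (ConjClasses.mk ((ψ v).symm ((UnitaryGroup.cmDatum L 3 (Matrix.of fun i j : Fin 3 => if i.val + j.val + 1 = 3 then (1 : L) else 0)).toLocal v x)))))
    (hx : ∀ v ∉ S₀, ((mG v).atPoint ((ψ v).symm ((UnitaryGroup.cmDatum L 3 (Matrix.of fun i j : Fin 3 => if i.val + j.val + 1 = 3 then (1 : L) else 0)).toLocal v x)))
      ((QuotientGroup.mk : _ → (UnitaryGroup.cmDatum L 3 H).Local v ⧸
          Subgroup.centralizer ({(ψ v).symm ((UnitaryGroup.cmDatum L 3 (Matrix.of fun i j : Fin 3 => if i.val + j.val + 1 = 3 then (1 : L) else 0)).toLocal v x)} : Set _)) ''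
        (UnitaryGroup.cmLocalIntegralLevel L 3 H v : Set _)) = 1) :
    UnitaryGroup.IsNormalisedOff L 3 (Matrix.of fun i j : Fin 3 => if i.val + j.val + 1 = 3 then (1 : L) else 0)
      (fun v => (mG v).transport (ψ v).toMulEquiv (ψ v).continuous (ψ v).symm.continuous) x S₀ := by
  intro v hv
  haveI := hinv v hv
  rw [transport_atPoint_image_cmLocalIntegralLevel L H ψ mG v (hψK v hv)]
  exact hx v hv

end CMDress

end Literature.NumberTheory.Rogawski1990

end
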